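import Mathlib
import Literature.MathematicalPhysics.MHD.SolovevFluxSurfaceGGJResistive
import Summits.Ventures.FusionMHD.Models.SolovevPCFGGJData
import HarnessLib

/-!
# Ventures/FusionMHD — Models/SolovevPCFResistiveIndex.lean: the Glasser–Greene–Johnson resistive-interchange
# index `D_R` of every flux surface of the two F1.a analytic equilibria of record (instance glue)

HONEST FRAMING (LADDER-GRIDFUSION three columns). MODELLED: the ANALYTIC Pataki–Cerfon–Freidberg Solov'ev
instances of `Models/SolovevPCF.lean` (ideal MHD, axisymmetric, `μ₀p′ = −1`, `FF′ = 0`, fixed boundary;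
«ITER-like»/«NSTX-like» name printed shape triples only), free constant `F = RB_φ`; `D_R` is the printed
index of the GGJ resistive singular-layer theory evaluated on these IDEAL-equilibrium inputs — «RESISTIVE-
INTERCHANGE INDEX SIGN (criterion as printed)», not a tearing / resistive-wall statement. CERTIFIED content
(kernel, this file): exact identities only; no enclosure, no sign, no stability word.

For each instance (`IterLike`, `NstxLike`) and every surface `0 < r < R_a/2` (edge `r = ε/R_a` admissible by
`edge_minorRadius`):
* `resistiveIndex F r := Solovev.lcResistiveIndex κ₀ F R_a (q₀F) (ε/R_a) F r` — `D_R` (Zheng 2015 (3.42),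
  typed by gridfusion-lit-3 on Hamada-label data) of the VOLUME-RELABELLED record `ggjData F r` with the two
  label-independent averages `⟨σB²⟩ = F` and `⟨B²⟩` of the surface (`Literature/…/SolovevFluxSurfaceGGJResistive.lean`);
* `avgBsq F r` — `⟨B²⟩` of the surface as the surface average (5.30) OF THE INSTANCE'S OWN `psi`, and
  `avgBsq_eq` — its explicit form `F²·∫w/u ÷ ∫w + ∫G·w/u ÷ ∫w` (ONE new 1-D integral beyond the Mercier set);
* `resistiveIndex_eq_mercierD` — `D_R = mercierD − 1/4 + (H − 1/2)²` with
  `H = V′⟨B²/G⟩/Λ·(⟨σB²/G⟩/⟨B²/G⟩ − F/⟨B²⟩)` (so `D_I ≤ D_R`; the informative certificate is the SIGN of `D_R`);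
* `mercierCriterion_of_resistiveIndex_neg` — a certified `D_R < 0` on a surface with shear (`Φ″ ≠ 0`)
  gives `(ggjData F r).MercierCriterion` in the kernel.
A Bench certificate is then ONE inequality on `resistiveIndex F r` closed from rational enclosures of the
Mercier-profile integrals plus `∫G·w/u` (gridfusion-sos-6, two lineages). Typer/prover: gridfusion-model-5 (g4),
2026-08-27. Citations: Zheng 2015 (2.64)/(3.42) [Zheng2015]; Jardin 2010 (5.30)/(8.134) [Jardin2010];
Lee–Cerfon 2015 §4.1 [LeeCerfon2015]; Pataki–Cerfon–Freidberg 2013 §6.1 [PatakiCerfonFreidberg2013].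
-/

noncomputable section

namespace Summit.Ventures.FusionMHD.Models.SolovevPCF

open Literature.MathematicalPhysics.MHD Literature.MathematicalPhysics.MHD.GradShafranov
  Literature.MathematicalPhysics.MHD.Solovev Literature.MathematicalPhysics.MHD.Mercier.FluxForm _root_.Real

namespace IterLike

/-- `D_R` of the surface `r` of the ITER-like instance at free constant `F`: the generic Lee–Cerfon
`lcResistiveIndex` with the instance's parameters `(κ₀, F, R_a, q₀(F), ε/R_a)`, `g = F`.
MODELLED: ideal-MHD equilibrium inputs of the GGJ resistive-layer index; Solov'ev profiles, analytic boundary. -/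
def resistiveIndex (F r : ℝ) : ℝ := lcResistiveIndex kappa0 F Ra (q0 F) (ε / Ra) F r

/-- `⟨B²⟩` of the surface `r` (Jardin (5.30)) of the instance's own `psi`, `B² = (F² + |∇Ψ|²)/R²`. -/
def avgBsq (F r : ℝ) : ℝ :=
  surfaceAverageE psi (lcLoop Ra kappa0 r) (2 * π) (fun R Z => fieldBsq (fun _ => F) psi R Z)

section surface

variable {F r : ℝ} (hF : 0 < F) (hr : 0 < r) (h2r : 2 * r < Ra)
include hF hr h2r

/-- `⟨B²⟩ = F²·∫w/u ÷ ∫w + ∫G·w/u ÷ ∫w` on the printed loop (`w = lcAvgWeight`, `u = lcU`, `G = lcGradSq`). -/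
theorem avgBsq_eq :
    avgBsq F r
      = F ^ 2 * ((∫ t in (0 : ℝ)..(2 * π), lcAvgWeight kappa0 F Ra (q0 F) r t / lcU Ra r t)
          / ∫ t in (0 : ℝ)..(2 * π), lcAvgWeight kappa0 F Ra (q0 F) r t)
        + (∫ t in (0 : ℝ)..(2 * π),
            lcGradSq kappa0 F Ra (q0 F) r t * lcAvgWeight kappa0 F Ra (q0 F) r t / lcU Ra r t)
          / ∫ t in (0 : ℝ)..(2 * π), lcAvgWeight kappa0 F Ra (q0 F) r t := by
  unfold avgBsq
  rw [psi_eq_psiLC hF.ne']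
  exact surfaceAverageE_lcLoop_bsq_split Ra_pos kappa0_pos hF (q0_pos hF) hr h2r F _

/-- `⟨B²⟩ > 0`. -/
theorem avgBsq_pos : 0 < avgBsq F r := by
  unfold avgBsq
  rw [psi_eq_psiLC hF.ne']
  exact surfaceAverageE_lcLoop_bsq_pos Ra_pos kappa0_pos hF (q0_pos hF) hr h2r F _

/-- **`D_R = mercierD − 1/4 + (H − 1/2)²`** on the surface, with
`H = V′⟨B²/G⟩/Λ·(⟨σB²/G⟩/⟨B²/G⟩ − F/⟨B²⟩)` (`⟨σB²⟩ = F` since `C_s = 1`), for surfaces with shear. -/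
theorem resistiveIndex_eq_mercierD (hΦ : (ggjData F r).Φ'' ≠ 0) :
    resistiveIndex F r
      = (ggjData F r).mercierD - 1 / 4
        + ((ggjData F r).V' * (ggjData F r).gB2 / (ggjData F r).shear
            * ((ggjData F r).gσB2 / (ggjData F r).gB2 - F / avgBsq F r) - 1 / 2) ^ 2 := by
  unfold resistiveIndex avgBsq
  rw [psi_eq_psiLC hF.ne',
    lcResistiveIndex_eq_mercierD Ra_pos kappa0_pos hF (q0_pos hF) hr h2r _ _ hΦ, csLC_eq_one hF, one_mul]
  rfl

/-- **Kernel consequence of a certified sign:** `D_R < 0` on a surface with shear gives Jardin's Mercier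
criterion (8.134) there (`D_I ≤ D_R`; force balance of the instance discharges the label change). -/
theorem mercierCriterion_of_resistiveIndex_neg (hΦ : (ggjData F r).Φ'' ≠ 0) (h : resistiveIndex F r < 0) :
    (ggjData F r).MercierCriterion :=
  mercierCriterion_of_lcResistiveIndex_neg Ra_pos kappa0_pos hF (q0_pos hF) hr h2r _ _ hΦ h

end surface

end IterLike

namespace NstxLike

/-- `D_R` of the surface `r` of the NSTX-like instance at free constant `F` (as for `IterLike`).
MODELLED: ideal-MHD equilibrium inputs of the GGJ resistive-layer index; Solov'ev profiles, analytic boundary. -/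
def resistiveIndex (F r : ℝ) : ℝ := lcResistiveIndex kappa0 F Ra (q0 F) (ε / Ra) F r

/-- `⟨B²⟩` of the surface `r` (Jardin (5.30)) of the instance's own `psi`. -/
def avgBsq (F r : ℝ) : ℝ :=
  surfaceAverageE psi (lcLoop Ra kappa0 r) (2 * π) (fun R Z => fieldBsq (fun _ => F) psi R Z)

section surface

variable {F r : ℝ} (hF : 0 < F) (hr : 0 < r) (h2r : 2 * r < Ra)
include hF hr h2r

/-- `⟨B²⟩ = F²·∫w/u ÷ ∫w + ∫G·w/u ÷ ∫w` on the printed loop. -/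
theorem avgBsq_eq :
    avgBsq F r
      = F ^ 2 * ((∫ t in (0 : ℝ)..(2 * π), lcAvgWeight kappa0 F Ra (q0 F) r t / lcU Ra r t)
          / ∫ t in (0 : ℝ)..(2 * π), lcAvgWeight kappa0 F Ra (q0 F) r t)
        + (∫ t in (0 : ℝ)..(2 * π),
            lcGradSq kappa0 F Ra (q0 F) r t * lcAvgWeight kappa0 F Ra (q0 F) r t / lcU Ra r t)
          / ∫ t in (0 : ℝ)..(2 * π), lcAvgWeight kappa0 F Ra (q0 F) r t := by
  unfold avgBsq
  rw [psi_eq_psiLC hF.ne']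
  exact surfaceAverageE_lcLoop_bsq_split Ra_pos kappa0_pos hF (q0_pos hF) hr h2r F _

/-- `⟨B²⟩ > 0`. -/
theorem avgBsq_pos : 0 < avgBsq F r := by
  unfold avgBsq
  rw [psi_eq_psiLC hF.ne']
  exact surfaceAverageE_lcLoop_bsq_pos Ra_pos kappa0_pos hF (q0_pos hF) hr h2r F _

/-- `D_R = mercierD − 1/4 + (H − 1/2)²` on the surface (as for `IterLike`). -/
theorem resistiveIndex_eq_mercierD (hΦ : (ggjData F r).Φ'' ≠ 0) :
    resistiveIndex F r
      = (ggjData F r).mercierD - 1 / 4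
        + ((ggjData F r).V' * (ggjData F r).gB2 / (ggjData F r).shear
            * ((ggjData F r).gσB2 / (ggjData F r).gB2 - F / avgBsq F r) - 1 / 2) ^ 2 := by
  unfold resistiveIndex avgBsq
  rw [psi_eq_psiLC hF.ne',
    lcResistiveIndex_eq_mercierD Ra_pos kappa0_pos hF (q0_pos hF) hr h2r _ _ hΦ, csLC_eq_one hF, one_mul]
  rfl

/-- `D_R < 0` on a surface with shear gives the Mercier criterion there. -/
theorem mercierCriterion_of_resistiveIndex_neg (hΦ : (ggjData F r).Φ'' ≠ 0) (h : resistiveIndex F r < 0) :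
    (ggjData F r).MercierCriterion :=
  mercierCriterion_of_lcResistiveIndex_neg Ra_pos kappa0_pos hF (q0_pos hF) hr h2r _ _ hΦ h

end surface

end NstxLike

end Summit.Ventures.FusionMHD.Models.SolovevPCF
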